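import Mathlib
import Summits.Parity.BatemanHorn.Theorems.AlmostPrimeZerosSystemMertensCounting
import Literature.NumberTheory.Sieve.PolynomialCongruencesMeanValues
import HarnessLib

/-!
# Crux `SystemMomentDeficit` (stmt-Parity-11326), line `Ideator3Sketch`: assembly, part 1 (algebra)

Helper lemmas for the assembly of the line (registered stub `stub_assembly` of the skeleton
`Cruxes/SystemMomentDeficit/Lines/Ideator3Sketch.lean`): the finite-probability algebra of the
moment deficit `E g − E g² + (E g)²` over `0 ≤ n ≤ x` (splitting of a sum, pair expansion,
covariance expansion), the index set `PP(z)` of primes `≤ z` and prime squares `≤ z` with the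
bridge to the tree's splitting of the capped statistic `s(m) = Σ_{p^v ∥ m} min(v,2)`, the
marginal root-class frequency bound, and small prime-sum / logarithm estimates.

Notation (docstrings only).  `Y = x + 1`, `E g = Y⁻¹ Σ_{0 ≤ n ≤ x} g(n)`, `m_i(n) = fᵢ(n)⁺`,
`PP(z)` = primes `≤ z` ∪ prime squares `≤ z`.  Everything is [folklore].
-/

namespace Summit.Parity.BatemanHorn.Cruxes.SystemMomentDeficit.Ideator3Sketch

open scoped BigOperators
open Finset Polynomial
open Literature.NumberTheory.Sieve
open Summit.Parity.BatemanHorn.Theorems.AlmostPrimeZeros.SystemMertens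

/-! ### Finite-probability algebra over `0 ≤ n ≤ x` -/

/-- The moment-deficit functional `E g − E g² + (E g)²` of a sum `g = a + b` splits as the two
deficits minus twice the covariance (`E` = mean over `range (x+1)`, written with the divisor `Y`).
[folklore] -/
theorem deficit_add_eq :
    ∀ (x : ℕ) (Y : ℝ) (a b : ℕ → ℝ),
    (∑ n ∈ range (x + 1), (a n + b n)) / Y - (∑ n ∈ range (x + 1), (a n + b n) ^ 2) / Y +
        ((∑ n ∈ range (x + 1), (a n + b n)) / Y) ^ 2 =
      ((∑ n ∈ range (x + 1), a n) / Y - (∑ n ∈ range (x + 1), a n ^ 2) / Y +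
          ((∑ n ∈ range (x + 1), a n) / Y) ^ 2) +
        ((∑ n ∈ range (x + 1), b n) / Y - (∑ n ∈ range (x + 1), b n ^ 2) / Y +
          ((∑ n ∈ range (x + 1), b n) / Y) ^ 2) -
        2 * ((∑ n ∈ range (x + 1), a n * b n) / Y -
          (∑ n ∈ range (x + 1), a n) / Y * ((∑ n ∈ range (x + 1), b n) / Y)) := by
  intro x Y a b
  have h1 : ∑ n ∈ range (x + 1), (a n + b n) ^ 2 =
      ∑ n ∈ range (x + 1), a n ^ 2 + 2 * ∑ n ∈ range (x + 1), a n * b n +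
        ∑ n ∈ range (x + 1), b n ^ 2 := by
    rw [mul_sum, ← sum_add_distrib, ← sum_add_distrib]
    exact sum_congr rfl fun n _ => by ring
  rw [sum_add_distrib, h1]
  ring

/-- The variance is nonnegative: `(E b)² ≤ E b²` on `range (x+1)` (Cauchy–Schwarz). [folklore] -/
theorem sq_mean_le_mean_sq (x : ℕ) (b : ℕ → ℝ) :
    ((∑ n ∈ range (x + 1), b n) / ((x : ℝ) + 1)) ^ 2 ≤
      (∑ n ∈ range (x + 1), b n ^ 2) / ((x : ℝ) + 1) := by
  have hY : (0 : ℝ) < (x : ℝ) + 1 := by positivity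
  have h := sq_sum_le_card_mul_sum_sq (s := range (x + 1)) (f := b)
  rw [card_range] at h
  push_cast at h
  rw [div_pow, div_le_div_iff₀ (by positivity) hY]
  nlinarith [h]

/-- Deficit of a sum of indicator-like terms: with `a = Σ_{t ∈ T} Z_t`,
`E a − E a² + (E a)² = Σ_{t,t'} (E Z_t · E Z_{t'} − E(Z_t Z_{t'}) + [t = t'] E Z_t)`. [folklore] -/
theorem deficit_sum_eq {τ : Type*} [DecidableEq τ] (T : Finset τ) (Z : τ → ℕ → ℝ) (x : ℕ)
    (Y : ℝ) :
    (∑ n ∈ range (x + 1), ∑ t ∈ T, Z t n) / Y -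
          (∑ n ∈ range (x + 1), (∑ t ∈ T, Z t n) ^ 2) / Y +
        ((∑ n ∈ range (x + 1), ∑ t ∈ T, Z t n) / Y) ^ 2 =
      ∑ t ∈ T, ∑ t' ∈ T,
        ((∑ n ∈ range (x + 1), Z t n) / Y * ((∑ n ∈ range (x + 1), Z t' n) / Y) -
            (∑ n ∈ range (x + 1), Z t n * Z t' n) / Y +
          if t = t' then (∑ n ∈ range (x + 1), Z t n) / Y else 0) := by
  have h1 : (∑ n ∈ range (x + 1), ∑ t ∈ T, Z t n) / Y = ∑ t ∈ T, (∑ n ∈ range (x + 1), Z t n) / Y := by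
    rw [sum_comm, sum_div]
  have h2 : (∑ n ∈ range (x + 1), (∑ t ∈ T, Z t n) ^ 2) / Y =
      ∑ t ∈ T, ∑ t' ∈ T, (∑ n ∈ range (x + 1), Z t n * Z t' n) / Y := by
    have : ∀ n, (∑ t ∈ T, Z t n) ^ 2 = ∑ t ∈ T, ∑ t' ∈ T, Z t n * Z t' n := fun n => by
      rw [sq, sum_mul_sum]
    simp_rw [this]
    rw [sum_comm, sum_div]
    refine sum_congr rfl fun t _ => ?_
    rw [sum_comm, sum_div]
  have h3 : (∑ t ∈ T, (∑ n ∈ range (x + 1), Z t n) / Y) ^ 2 =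
      ∑ t ∈ T, ∑ t' ∈ T, (∑ n ∈ range (x + 1), Z t n) / Y * ((∑ n ∈ range (x + 1), Z t' n) / Y) := by
    rw [sq, sum_mul_sum]
  rw [h1, h2, h3]
  have h4 : ∀ t ∈ T, (∑ t' ∈ T,
      ((∑ n ∈ range (x + 1), Z t n) / Y * ((∑ n ∈ range (x + 1), Z t' n) / Y) -
          (∑ n ∈ range (x + 1), Z t n * Z t' n) / Y +
        if t = t' then (∑ n ∈ range (x + 1), Z t n) / Y else 0)) =
      ∑ t' ∈ T, (∑ n ∈ range (x + 1), Z t n) / Y * ((∑ n ∈ range (x + 1), Z t' n) / Y) -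
        ∑ t' ∈ T, (∑ n ∈ range (x + 1), Z t n * Z t' n) / Y +
        (∑ n ∈ range (x + 1), Z t n) / Y := by
    intro t ht
    rw [sum_add_distrib, sum_sub_distrib, sum_ite_eq, if_pos ht]
  rw [sum_congr rfl h4, sum_add_distrib, sum_sub_distrib]
  ring

/-- Covariance of two sums: with `a = Σ_{t ∈ T} Z_t`, `u = Σ_{t' ∈ T'} Z'_{t'}`,
`E(au) − E a · E u = Σ_{t,t'} (E(Z_t Z'_{t'}) − E Z_t · E Z'_{t'})`. [folklore] -/
theorem cov_sum_eq {τ τ' : Type*} (T : Finset τ) (T' : Finset τ') (Z : τ → ℕ → ℝ)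
    (Z' : τ' → ℕ → ℝ) (x : ℕ) (Y : ℝ) :
    (∑ n ∈ range (x + 1), (∑ t ∈ T, Z t n) * ∑ t' ∈ T', Z' t' n) / Y -
        (∑ n ∈ range (x + 1), ∑ t ∈ T, Z t n) / Y * ((∑ n ∈ range (x + 1), ∑ t' ∈ T', Z' t' n) / Y) =
      ∑ t ∈ T, ∑ t' ∈ T',
        ((∑ n ∈ range (x + 1), Z t n * Z' t' n) / Y -
          (∑ n ∈ range (x + 1), Z t n) / Y * ((∑ n ∈ range (x + 1), Z' t' n) / Y)) := by
  have h1 : (∑ n ∈ range (x + 1), ∑ t ∈ T, Z t n) / Y = ∑ t ∈ T, (∑ n ∈ range (x + 1), Z t n) / Y := by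
    rw [sum_comm, sum_div]
  have h1' : (∑ n ∈ range (x + 1), ∑ t' ∈ T', Z' t' n) / Y =
      ∑ t' ∈ T', (∑ n ∈ range (x + 1), Z' t' n) / Y := by
    rw [sum_comm, sum_div]
  have h2 : (∑ n ∈ range (x + 1), (∑ t ∈ T, Z t n) * ∑ t' ∈ T', Z' t' n) / Y =
      ∑ t ∈ T, ∑ t' ∈ T', (∑ n ∈ range (x + 1), Z t n * Z' t' n) / Y := by
    simp_rw [sum_mul_sum]
    rw [sum_comm, sum_div]
    refine sum_congr rfl fun t _ => ?_
    rw [sum_comm, sum_div]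
  rw [h1, h1', h2, sum_mul_sum, ← sum_sub_distrib]
  refine sum_congr rfl fun t _ => ?_
  rw [← sum_sub_distrib]

/-- Product of two `0/1` indicators is the indicator of the conjunction. [folklore] -/
theorem ite_one_zero_mul_ite (P Q : Prop) [Decidable P] [Decidable Q] :
    (if P then (1 : ℝ) else 0) * (if Q then (1 : ℝ) else 0) = if P ∧ Q then 1 else 0 := by
  split_ifs <;> simp_all


/-! ### The prime powers `PP(z)`: primes `≤ z` and prime squares `≤ z` -/


/-- Membership in `PP(z)`. [folklore] -/
theorem mem_PP_iff {z q : ℕ} :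
    q ∈ (Nat.primesLE z ∪ ((Nat.primesLE z).filter (fun p => p ^ 2 ≤ z)).image (fun p => p ^ 2)) ↔ (q.Prime ∧ q ≤ z) ∨ ∃ p, p.Prime ∧ p ^ 2 ≤ z ∧ p ^ 2 = q := by
  simp only [mem_union, mem_image, mem_filter, Nat.mem_primesLE]
  constructor
  · rintro (⟨hq, hp⟩ | ⟨p, ⟨⟨-, hp⟩, hpz⟩, rfl⟩)
    · exact Or.inl ⟨hp, hq⟩
    · exact Or.inr ⟨p, hp, hpz, rfl⟩
  · rintro (⟨hp, hq⟩ | ⟨p, hp, hpz, rfl⟩)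
    · exact Or.inl ⟨hq, hp⟩
    · refine Or.inr ⟨p, ⟨⟨?_, hp⟩, hpz⟩, rfl⟩
      exact le_trans (Nat.le_self_pow two_ne_zero p) hpz

/-- Every element of `PP(z)` is a prime power `≥ 2` and `≤ z`. [folklore] -/
theorem isPrimePow_and_le_of_mem_PP {z q : ℕ} (hq : q ∈ (Nat.primesLE z ∪ ((Nat.primesLE z).filter (fun p => p ^ 2 ≤ z)).image (fun p => p ^ 2))) :
    IsPrimePow q ∧ 2 ≤ q ∧ q ≤ z := by
  rcases mem_PP_iff.1 hq with ⟨hp, hqz⟩ | ⟨p, hp, hpz, rfl⟩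
  · exact ⟨hp.isPrimePow, hp.two_le, hqz⟩
  · exact ⟨hp.isPrimePow.pow two_ne_zero, le_trans hp.two_le (Nat.le_self_pow two_ne_zero p), hpz⟩

/-- `PP` is monotone. [folklore] -/
theorem PP_mono {y z : ℕ} (h : y ≤ z) : (Nat.primesLE y ∪ ((Nat.primesLE y).filter (fun p => p ^ 2 ≤ y)).image (fun p => p ^ 2)) ⊆ (Nat.primesLE z ∪ ((Nat.primesLE z).filter (fun p => p ^ 2 ≤ z)).image (fun p => p ^ 2)) := by
  intro q hq
  rcases mem_PP_iff.1 hq with ⟨hp, hqy⟩ | ⟨p, hp, hpy, rfl⟩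
  · exact mem_PP_iff.2 (Or.inl ⟨hp, hqy.trans h⟩)
  · exact mem_PP_iff.2 (Or.inr ⟨p, hp, hpy.trans h, rfl⟩)

/-- A sum of nonnegative terms over `PP(z)` is at most the sum over the primes `p ≤ z` of `g p` plus
the sum over the primes `p` with `p² ≤ z` of `g (p²)`. [folklore] -/
theorem sum_PP_le {z : ℕ} {g : ℕ → ℝ} (hg : ∀ q, 0 ≤ g q) :
    ∑ q ∈ (Nat.primesLE z ∪ ((Nat.primesLE z).filter (fun p => p ^ 2 ≤ z)).image (fun p => p ^ 2)), g q ≤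
      ∑ p ∈ Nat.primesLE z, g p + ∑ p ∈ (Nat.primesLE z).filter (fun p => p ^ 2 ≤ z), g (p ^ 2) := by
  have hinj : Set.InjOn (fun p : ℕ => p ^ 2) ↑((Nat.primesLE z).filter (fun p => p ^ 2 ≤ z)) :=
    fun a _ b _ hab => Nat.pow_left_injective two_ne_zero hab
  rw [← sum_image hinj]
  set A := Nat.primesLE z
  set B := ((Nat.primesLE z).filter (fun p => p ^ 2 ≤ z)).image (fun p => p ^ 2)
  calc ∑ q ∈ A ∪ B, g q = ∑ q ∈ A, g q + ∑ q ∈ B \ A, g q := by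
        rw [← sum_union disjoint_sdiff, union_sdiff_self_eq_union]
    _ ≤ ∑ q ∈ A, g q + ∑ q ∈ B, g q := by
        gcongr ∑ q ∈ A, g q + ?_
        exact sum_le_sum_of_subset_of_nonneg sdiff_subset fun q _ _ => hg q

/-- Bridge to the tree's splitting of the capped statistic: for every `m`,
`#{q ∈ PP(z) : q ∣ m ≠ 0} = #{p ∣ m prime : p ≤ z} + #{p ∣ m prime : p² ∣ m, p² ≤ z}`. [folklore] -/
theorem card_PP_filter_dvd (z m : ℕ) :
    #(((Nat.primesLE z ∪ ((Nat.primesLE z).filter (fun p => p ^ 2 ≤ z)).image (fun p => p ^ 2))).filter (fun q => q ∣ m ∧ m ≠ 0)) =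
      #(m.primeFactors.filter (fun p => p ≤ z)) +
        #(m.primeFactors.filter (fun p => p ^ 2 ∣ m ∧ p ^ 2 ≤ z)) := by
  rw [filter_union, card_union_of_disjoint]
  · congr 1
    · congr 1
      ext p
      simp only [mem_filter, Nat.mem_primesLE, Nat.mem_primeFactors]
      tauto
    · rw [filter_image, card_image_of_injOn]
      · congr 1
        ext p
        simp only [mem_filter, Nat.mem_primesLE, Nat.mem_primeFactors]
        constructor
        · rintro ⟨⟨⟨-, hp⟩, hpz⟩, hd, hm⟩
          exact ⟨⟨hp, dvd_trans (dvd_pow_self p two_ne_zero) hd, hm⟩, hd, hpz⟩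
        · rintro ⟨⟨hp, -, hm⟩, hd, hpz⟩
          exact ⟨⟨⟨le_trans (Nat.le_self_pow two_ne_zero p) hpz, hp⟩, hpz⟩, hd, hm⟩
      · exact fun a _ b _ hab => Nat.pow_left_injective two_ne_zero hab
  · rw [disjoint_left]
    intro q hq hq'
    simp only [mem_filter, mem_image, Nat.mem_primesLE] at hq hq'
    obtain ⟨⟨p, ⟨-, -⟩, rfl⟩, -⟩ := hq'
    have hp2 : (p ^ 2).Prime := hq.1.2
    have hp1 : p ≠ 1 := by
      rintro rfl
      exact Nat.not_prime_one (by simpa using hp2)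
    exact absurd ((Nat.squarefree_pow_iff hp1 two_ne_zero).1 hp2.squarefree).2 (by norm_num)


/-- Union bound for sums of nonnegative terms. [folklore] -/
theorem sum_union_le_add {α : Type*} [DecidableEq α] {s t : Finset α} {g : α → ℝ}
    (hg : ∀ a, 0 ≤ g a) : ∑ a ∈ s ∪ t, g a ≤ ∑ a ∈ s, g a + ∑ a ∈ t, g a := by
  calc ∑ a ∈ s ∪ t, g a = ∑ a ∈ s, g a + ∑ a ∈ t \ s, g a := by
        rw [← sum_union disjoint_sdiff, union_sdiff_self_eq_union]
    _ ≤ ∑ a ∈ s, g a + ∑ a ∈ t, g a := by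
        gcongr ∑ a ∈ s, g a + ?_
        exact sum_le_sum_of_subset_of_nonneg sdiff_subset fun a _ _ => hg a

/-- A sum of nonnegative terms over `PP(x) ∖ PP(z)` is at most the sum over the primes `z < p ≤ x`
of `g p` plus the sum over all primes `p` with `p² ≤ x` of `g (p²)`. [folklore] -/
theorem sum_PP_sdiff_le {z x : ℕ} {g : ℕ → ℝ} (hg : ∀ q, 0 ≤ g q) :
    ∑ q ∈ (Nat.primesLE x ∪ ((Nat.primesLE x).filter (fun p => p ^ 2 ≤ x)).image (fun p => p ^ 2)) \ (Nat.primesLE z ∪ ((Nat.primesLE z).filter (fun p => p ^ 2 ≤ z)).image (fun p => p ^ 2)), g q ≤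
      ∑ p ∈ (Nat.primesLE x).filter (fun p => z < p), g p +
        ∑ p ∈ (Nat.primesLE x).filter (fun p => p ^ 2 ≤ x), g (p ^ 2) := by
  have hinj : Set.InjOn (fun p : ℕ => p ^ 2) ↑((Nat.primesLE x).filter (fun p => p ^ 2 ≤ x)) :=
    fun a _ b _ hab => Nat.pow_left_injective two_ne_zero hab
  rw [← sum_image hinj]
  refine le_trans (sum_le_sum_of_subset_of_nonneg (fun q hq => ?_) fun q _ _ => hg q)
    (sum_union_le_add hg)
  rw [mem_sdiff] at hq
  obtain ⟨hqx, hqz⟩ := hq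
  rw [mem_union]
  rcases mem_union.1 hqx with h | h
  · refine Or.inl (mem_filter.2 ⟨h, ?_⟩)
    by_contra hle
    exact hqz (mem_union.2 (Or.inl (Nat.mem_primesLE.2 ⟨not_lt.1 hle, (Nat.mem_primesLE.1 h).2⟩)))
  · exact Or.inr h

/-- `Σ_{p prime, p² ≤ x} 1/p² ≤ 1`. [folklore] -/
theorem sum_primesLE_sq_inv_le_one (x : ℕ) :
    ∑ p ∈ (Nat.primesLE x).filter (fun p => p ^ 2 ≤ x), (1 : ℝ) / ((p : ℝ) ^ 2) ≤ 1 := by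
  rcases Nat.eq_zero_or_pos x with rfl | hx
  · simp
  simp_rw [one_div]
  calc ∑ p ∈ (Nat.primesLE x).filter (fun p => p ^ 2 ≤ x), ((p : ℝ) ^ 2)⁻¹
      ≤ ∑ i ∈ Ioc 1 x, ((i : ℝ) ^ 2)⁻¹ := by
        refine sum_le_sum_of_subset_of_nonneg (fun p hp => ?_) fun i _ _ => by positivity
        simp only [mem_filter, Nat.mem_primesLE] at hp
        rw [mem_Ioc]
        exact ⟨hp.1.2.one_lt, hp.1.1⟩
    _ ≤ (1 : ℝ)⁻¹ - (x : ℝ)⁻¹ := by exact_mod_cast sum_Ioc_inv_sq_le_sub one_ne_zero hx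
    _ ≤ 1 := by rw [inv_one, sub_le_self_iff]; positivity

/-- `log x ≤ 2 log ⌊√x⌋ + 2` for `x ≥ 1`. [folklore] -/
theorem log_le_two_mul_log_sqrt_add_two {x : ℕ} (hx : 1 ≤ x) :
    Real.log x ≤ 2 * Real.log (Nat.sqrt x) + 2 := by
  have hs : 1 ≤ Nat.sqrt x := Nat.le_sqrt.2 (by omega)
  have hsR : (1 : ℝ) ≤ Nat.sqrt x := by exact_mod_cast hs
  have hlt : x < (Nat.sqrt x + 1) * (Nat.sqrt x + 1) := Nat.lt_succ_sqrt x
  have h1 : (x : ℝ) ≤ 4 * (Nat.sqrt x : ℝ) ^ 2 := by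
    have : (x : ℝ) < ((Nat.sqrt x : ℝ) + 1) * ((Nat.sqrt x : ℝ) + 1) := by exact_mod_cast hlt
    nlinarith
  have hx0 : (0 : ℝ) < x := by exact_mod_cast hx
  have h4 : Real.log 4 ≤ 2 := by
    have h := Real.exp_one_gt_d9
    have : (4 : ℝ) ≤ Real.exp 2 := by
      have h2 : Real.exp 2 = Real.exp 1 * Real.exp 1 := by rw [← Real.exp_add]; norm_num
      nlinarith [Real.exp_pos 1]
    calc Real.log 4 ≤ Real.log (Real.exp 2) := Real.log_le_log (by norm_num) this
      _ = 2 := Real.log_exp 2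
  calc Real.log x ≤ Real.log (4 * (Nat.sqrt x : ℝ) ^ 2) := Real.log_le_log hx0 h1
    _ = Real.log 4 + 2 * Real.log (Nat.sqrt x) := by
        rw [Real.log_mul (by norm_num) (by positivity), Real.log_pow]; push_cast; ring
    _ ≤ _ := by linarith

/-! ### Counting in root classes -/

/-- Marginal frequency of `q ∣ g(n)⁺ ≠ 0` over `0 ≤ n ≤ x`: at most `ρ_g(q)(1/q + 1/(x+1))`.
[folklore] -/
theorem card_filter_dvd_toNat_div_le (g : ℤ[X]) {q : ℕ} (hq : 0 < q) (x : ℕ) :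
    (#((range (x + 1)).filter fun n : ℕ => q ∣ (g.eval (n : ℤ)).toNat ∧ (g.eval (n : ℤ)).toNat ≠ 0) : ℝ) /
        ((x : ℝ) + 1) ≤
      (polyRootCountMod ![g] q : ℝ) * (1 / (q : ℝ) + 1 / ((x : ℝ) + 1)) := by
  have hY : (0 : ℝ) < (x : ℝ) + 1 := by positivity
  have hq' : (0 : ℝ) < q := by exact_mod_cast hq
  have h1 : #((range (x + 1)).filter fun n : ℕ => q ∣ (g.eval (n : ℤ)).toNat ∧ (g.eval (n : ℤ)).toNat ≠ 0) ≤
      #((range (x + 1)).filter fun n : ℕ => (q : ℤ) ∣ g.eval (n : ℤ)) :=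
    card_le_card fun n hn => by
      rw [mem_filter] at hn ⊢
      exact ⟨hn.1, (dvd_toNat_and_ne_zero_iff.1 hn.2).2⟩
  have h2 := card_filter_range_dvd_eval_le g hq (x + 1)
  have h3 : (#((range (x + 1)).filter fun n : ℕ => q ∣ (g.eval (n : ℤ)).toNat ∧ (g.eval (n : ℤ)).toNat ≠ 0) : ℝ) ≤
      (polyRootCountMod ![g] q : ℝ) * ((((x + 1) / q : ℕ) : ℝ) + 1) := by exact_mod_cast h1.trans h2
  have h4 : (((x + 1) / q : ℕ) : ℝ) ≤ ((x : ℝ) + 1) / q := by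
    have := Nat.cast_div_le (m := x + 1) (n := q) (α := ℝ)
    push_cast at this
    exact this
  have hρ : (0 : ℝ) ≤ polyRootCountMod ![g] q := Nat.cast_nonneg _
  rw [div_le_iff₀ hY]
  calc _ ≤ (polyRootCountMod ![g] q : ℝ) * (((x : ℝ) + 1) / q + 1) := h3.trans (by gcongr)
    _ = _ := by field_simp

/-- The small count is below the capped statistic: `#{q ∈ PP(x) : q ∣ m ≠ 0} ≤ s(m)`. [folklore] -/
theorem card_PP_filter_le_capped (x m : ℕ) :
    #(((Nat.primesLE x ∪ ((Nat.primesLE x).filter (fun p => p ^ 2 ≤ x)).image (fun p => p ^ 2))).filter (fun q => q ∣ m ∧ m ≠ 0)) ≤ (m.factorization.sum fun _ v => min v 2) := by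
  rw [card_PP_filter_dvd, capped_eq_card_add_card]
  exact Nat.add_le_add (card_le_card (filter_subset _ _))
    (card_le_card fun p hp => by
      simp only [mem_filter] at hp ⊢
      exact ⟨hp.1, hp.2.1⟩)

/-- The capped statistic exceeds the small count at height `x` by at most `2(d + H)` along the
values `g(n)⁺`, `0 ≤ n ≤ x`, `x ≥ 1` (`H = Σ |coeff|`). [folklore] -/
theorem capped_le_card_PP_filter_add (g : ℤ[X]) {n x : ℕ} (hx : 1 ≤ x) (hn : n ≤ x) :
    ((g.eval (n : ℤ)).toNat.factorization.sum fun _ v => min v 2) ≤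
      #(((Nat.primesLE x ∪ ((Nat.primesLE x).filter (fun p => p ^ 2 ≤ x)).image (fun p => p ^ 2))).filter (fun q => q ∣ (g.eval (n : ℤ)).toNat ∧ (g.eval (n : ℤ)).toNat ≠ 0)) +
        2 * (g.natDegree + ∑ j ∈ range (g.natDegree + 1), (g.coeff j).natAbs) := by
  rw [card_PP_filter_dvd]
  have := capped_le_card_add hx (toNat_eval_le g hn)
  omega

/-- Sums over `univ ×ˢ S` of a function of the second coordinate. [folklore] -/
theorem sum_univ_prod {k : ℕ} (S : Finset ℕ) (h : ℕ → ℝ) :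
    ∑ t ∈ (univ : Finset (Fin k)) ×ˢ S, h t.2 = (k : ℝ) * ∑ q ∈ S, h q := by
  rw [sum_product]
  simp only [sum_const, card_univ, Fintype.card_fin, nsmul_eq_mul]

/-- Double sums over `univ ×ˢ S` of a function of the second coordinates. [folklore] -/
theorem sum_univ_prod_sum_univ_prod {k : ℕ} (S S' : Finset ℕ) (h : ℕ → ℕ → ℝ) :
    ∑ t ∈ (univ : Finset (Fin k)) ×ˢ S, ∑ t' ∈ (univ : Finset (Fin k)) ×ˢ S', h t.2 t'.2 =
      (k : ℝ) ^ 2 * ∑ qq ∈ S ×ˢ S', h qq.1 qq.2 := by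
  have h1 : ∀ t : Fin k × ℕ, ∑ t' ∈ (univ : Finset (Fin k)) ×ˢ S', h t.2 t'.2 =
      (k : ℝ) * ∑ q' ∈ S', h t.2 q' := fun t => sum_univ_prod S' (h t.2)
  simp_rw [h1]
  rw [sum_univ_prod S (fun q => (k : ℝ) * ∑ q' ∈ S', h q q'), ← mul_sum, sum_product']
  ring

/-- A filtered double sum written as a sum over the filtered product. [folklore] -/
theorem sum_sum_filter_eq_sum_product_filter (S S' : Finset ℕ) (P : ℕ → ℕ → Prop)
    [DecidablePred fun qq : ℕ × ℕ => P qq.1 qq.2] [∀ q, DecidablePred (P q)] (g : ℕ → ℕ → ℝ) :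
    ∑ q ∈ S, ∑ q' ∈ S'.filter (P q), g q q' =
      ∑ qq ∈ (S ×ˢ S').filter (fun qq => P qq.1 qq.2), g qq.1 qq.2 := by
  rw [sum_filter, sum_product]
  refine sum_congr rfl fun q _ => ?_
  rw [sum_filter]


end Summit.Parity.BatemanHorn.Cruxes.SystemMomentDeficit.Ideator3Sketch
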